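import Summits.FinalStateConjecture.FinalStateConjecture.Theorems.EIHFluxBalanceInertialRecessionStubSlaving12JetCompact
import Summits.FinalStateConjecture.FinalStateConjecture.Theorems.EIHFluxBalanceInertialRecessionStubSlaving11AnsatzBound
import Summits.FinalStateConjecture.FinalStateConjecture.Theorems.EIHFluxBalanceInertialRecessionStubHigherOrderAnsatzField

/-!
# Route EIHFluxBalance — `InertialRecession` (E′), line `SketchCleanExcision`, skeleton r13,
# stub `stub_higherOrderSlaving` (EF): the frozen ansatz is a uniformly nondegenerate field of
# metric components on every late hole-following tube

Helper file for the crux `stmt-FinalStateConjecture-17403`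
(`Summit.FinalStateConjecture.FinalStateConjecture.Theses.EIHFluxBalance.InertialRecession`, E′),
registered stub `stub_higherOrderSlaving` (orders two and three of frozen-vacuum slaving).

`higherOrder_tube`: for painted moduli with Lorentz factors `≤ γ`, smooth motions and separating
centres, on the late tube `{x⁰ > T, ‖x̃ − ξᵢ(x⁰)‖ < R, rᵢ > r₀}` around hole `i` the frozen
ansatz `g₀` is a field of metric components (smooth, symmetric, nondegenerate), all painted radii
are positive, `‖v‖ ≤ m⁻¹‖g₀(x)v‖` and `‖g₀(x)‖ ≤ α` with `m, α` depending only on the data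
(`eventually_ansatz_coercive_near_hole`, `eventually_norm_ansatz_le_near_hole`,
`contDiffAt_ansatzBilin'`). This is the geometric input of the higher-order slaving steps, where
the coercivity statement `stub_coerSymbolQuant` is applied to the re-centred ansatz.

No definitions, no named facts, no `sorry`.
-/

set_option linter.dupNamespace false
set_option maxSynthPendingDepth 6
set_option synthInstance.maxHeartbeats 200000

noncomputable section

namespace Summit.FinalStateConjecture.FinalStateConjecture.Theorems.SublinearIsFree.Slaving

open scoped Topology ContDiff BigOperators
open Filter Set Function Metric Literature.Geometry.Lorentzian
  Summit.FinalStateConjecture.FinalStateConjecture.Theorems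
open MetricCoord

/-- The painted radius of hole `i` and the distance to its centre are continuous on spacetime.
[folklore] -/
theorem higherOrder_continuous_tubeData {Λ : ℝ → lorentzGroup} {ξ : ℝ → E3} (a : ℝ)
    (hΛ : ContDiff ℝ ∞ (fun t ↦ ((Λ t : E4 ≃L[ℝ] E4) : E4 →L[ℝ] E4))) (hξ : ContDiff ℝ ∞ ξ) :
    Continuous (fun z : E4 ↦ Kerr.radius a (poincareInv (Λ (z 0)) (E4.ofTimeSpace (z 0) (ξ (z 0))) z)) ∧
    Continuous (fun z : E4 ↦ ‖E4.spatial z - ξ (z 0)‖) := by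
  have h0 : ContDiff ℝ ∞ (fun z : E4 ↦ z 0) := (EuclideanSpace.proj (0 : Fin 4) : E4 →L[ℝ] ℝ).contDiff
  have hA : ContDiff ℝ ∞ (fun z : E4 ↦ (((Λ (z 0) : E4 ≃L[ℝ] E4).symm : E4 ≃L[ℝ] E4) : E4 →L[ℝ] E4)) :=
    (contDiff_lorentz_symm hΛ).comp h0
  have hc : ContDiff ℝ ∞ (fun z : E4 ↦ E4.ofTimeSpace (z 0) (ξ (z 0))) := by
    have e : (fun z : E4 ↦ E4.ofTimeSpace (z 0) (ξ (z 0))) =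
        fun z ↦ (z 0) • E4.basisVector 0 + E4.spaceEmbed (ξ (z 0)) := funext fun z ↦ E4.ofTimeSpace_eq_smul_add' _ _
    rw [e]; exact (h0.smul contDiff_const).add (E4.spaceEmbed.contDiff.comp (hξ.comp h0))
  have hP : ContDiff ℝ ∞ (fun z : E4 ↦ poincareInv (Λ (z 0)) (E4.ofTimeSpace (z 0) (ξ (z 0))) z) := by
    show ContDiff ℝ ∞ (fun z : E4 ↦ ((Λ (z 0) : E4 ≃L[ℝ] E4).symm) (z - E4.ofTimeSpace (z 0) (ξ (z 0))))
    exact hA.clm_apply (contDiff_id.sub hc)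
  refine ⟨?_, ?_⟩
  · have h := (Kerr.continuous_radius a).comp hP.continuous; exact h
  · exact (E4.spatial.continuous.sub ((hξ.continuous).comp h0.continuous)).norm

set_option maxHeartbeats 1600000 in
/-- **The frozen ansatz on a late hole-following tube.** See the module docstring. [folklore] -/
theorem higherOrder_tube {N : ℕ} {M a : Fin N → ℝ} {Λ : Fin N → ℝ → lorentzGroup} {ξ : Fin N → ℝ → E3}
    {γ : ℝ} (hγ : ∀ i t, |((Λ i t : E4 ≃L[ℝ] E4) (E4.basisVector 0)) 0| ≤ γ)
    (hsm : ∀ i, ContDiff ℝ ∞ (ξ i) ∧ ContDiff ℝ ∞ (fun t ↦ ((Λ i t : E4 ≃L[ℝ] E4) : E4 →L[ℝ] E4)))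
    (hsep : ∀ i j, i ≠ j → Tendsto (fun t ↦ ‖ξ i t - ξ j t‖) atTop atTop)
    (i : Fin N) (R : ℝ) {r₀ : ℝ} (hr₀ : 0 < r₀) :
    ∃ T m α : ℝ, 0 < m ∧ 0 ≤ α ∧
      IsMetricOn (fun z : E4 ↦ Minkowski.bilin + ∑ j, (boostedKerrBilin (Λ j (z 0))
        (E4.ofTimeSpace (z 0) (ξ j (z 0))) (M j) (a j) z - Minkowski.bilin))
        {z : E4 | T < z 0 ∧ ‖E4.spatial z - ξ i (z 0)‖ < R ∧
          r₀ < Kerr.radius (a i) (poincareInv (Λ i (z 0)) (E4.ofTimeSpace (z 0) (ξ i (z 0))) z)} ∧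
      ∀ z : E4, T < z 0 → ‖E4.spatial z - ξ i (z 0)‖ ≤ R →
        r₀ ≤ Kerr.radius (a i) (poincareInv (Λ i (z 0)) (E4.ofTimeSpace (z 0) (ξ i (z 0))) z) →
        (∀ j, 0 < Kerr.radius (a j) (poincareInv (Λ j (z 0)) (E4.ofTimeSpace (z 0) (ξ j (z 0))) z)) ∧
        (∀ v : E4, m * ‖v‖ ≤ ‖(Minkowski.bilin + ∑ j, (boostedKerrBilin (Λ j (z 0))
          (E4.ofTimeSpace (z 0) (ξ j (z 0))) (M j) (a j) z - Minkowski.bilin)) v‖) ∧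
        ‖Minkowski.bilin + ∑ j, (boostedKerrBilin (Λ j (z 0))
          (E4.ofTimeSpace (z 0) (ξ j (z 0))) (M j) (a j) z - Minkowski.bilin)‖ ≤ α := by
  set g₀ : E4 → E4 →L[ℝ] E4 →L[ℝ] ℝ := (fun z : E4 ↦ Minkowski.bilin + ∑ j, (boostedKerrBilin (Λ j (z 0))
    (E4.ofTimeSpace (z 0) (ξ j (z 0))) (M j) (a j) z - Minkowski.bilin)) with hg₀
  have hγ1 : 1 ≤ γ := (one_le_abs_lorentz_apply_zero (Λ i 0)).trans (hγ i 0)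
  have hK₀ : 0 < (1 + 3 * γ) ^ 2 * (1 + 4 * (|M i| / r₀)) :=
    mul_pos (pow_pos (by linarith) 2) (by positivity)
  set m : ℝ := ((1 + 3 * γ) ^ 2 * (1 + 4 * (|M i| / r₀)))⁻¹ / 2 with hm
  have hm0 : 0 < m := by positivity
  set α : ℝ := ‖(Minkowski.bilin : E4 →L[ℝ] E4 →L[ℝ] ℝ)‖ +
    ∑ j, 4 * (|M j| / min r₀ 1) * (1 + 3 * γ) ^ 2 with hα
  have hα0 : 0 ≤ α := by positivity
  have E1 := eventually_ansatz_coercive_near_hole (M := M) (a := a) hγ hsep i R hr₀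
  have E2 := eventually_norm_ansatz_le_near_hole (M := M) (a := a) hγ hsep i R hr₀
  obtain ⟨T, hT⟩ := eventually_atTop.1 (E1.and E2)
  have hfacts : ∀ z : E4, T < z 0 → ‖E4.spatial z - ξ i (z 0)‖ ≤ R →
      r₀ ≤ Kerr.radius (a i) (poincareInv (Λ i (z 0)) (E4.ofTimeSpace (z 0) (ξ i (z 0))) z) →
      (∀ j, 0 < Kerr.radius (a j) (poincareInv (Λ j (z 0)) (E4.ofTimeSpace (z 0) (ξ j (z 0))) z)) ∧
      (∀ v : E4, m * ‖v‖ ≤ ‖g₀ z v‖) ∧ ‖g₀ z‖ ≤ α := by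
    intro z hzT hzR hzr
    obtain ⟨h1, h2⟩ := hT (z 0) hzT.le
    obtain ⟨hr, hc⟩ := h1 z rfl hzR hzr
    exact ⟨hr, hc, h2 z rfl hzR hzr⟩
  refine ⟨T, m, α, hm0, hα0, ?_, hfacts⟩
  -- openness of the tube
  obtain ⟨hcr, hcd⟩ := higherOrder_continuous_tubeData (a i) (hsm i).2 (hsm i).1
  have hopen : IsOpen {z : E4 | T < z 0 ∧ ‖E4.spatial z - ξ i (z 0)‖ < R ∧
      r₀ < Kerr.radius (a i) (poincareInv (Λ i (z 0)) (E4.ofTimeSpace (z 0) (ξ i (z 0))) z)} := by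
    refine (isOpen_lt continuous_const (EuclideanSpace.proj (0 : Fin 4)).continuous).inter
      ((isOpen_lt hcd continuous_const).inter (isOpen_lt continuous_const hcr))
  refine ⟨hopen, fun z hz ↦ ?_, fun z _ v w ↦ ?_, fun z hz ↦ ?_⟩
  · exact (contDiffAt_ansatzBilin' N M a Λ ξ (fun j ↦ (hsm j).2) (fun j ↦ (hsm j).1) z
      (hfacts z hz.1 hz.2.1.le hz.2.2.le).1).contDiffWithinAt
  · show (Minkowski.bilin + ∑ i, (boostedKerrBilin (Λ i (z 0)) (E4.ofTimeSpace (z 0) (ξ i (z 0)))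
      (M i) (a i) z - Minkowski.bilin)) v w = (Minkowski.bilin + ∑ i, (boostedKerrBilin (Λ i (z 0))
      (E4.ofTimeSpace (z 0) (ξ i (z 0))) (M i) (a i) z - Minkowski.bilin)) w v
    simp only [add_apply, FunLike.coe_sum, Finset.sum_apply,
      sub_apply, Minkowski.bilin_symm v w, boostedKerrBilin_symm _ _ _ _ z v w]
  · refine MetricCoord.isInvertible_of_nondegenerate fun v hv ↦ ?_
    have h0 : g₀ z v = 0 := ContinuousLinearMap.ext fun w ↦ hv w
    have h1' := (hfacts z hz.1 hz.2.1.le hz.2.2.le).2.1 v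
    rw [h0, norm_zero] at h1'
    have h2 : ‖v‖ ≤ 0 := by nlinarith [norm_nonneg v]
    exact norm_le_zero_iff.1 h2

/-- **Registered one-line carrier form** (`higherOrder_tubeData_EF`) of
`higherOrder_continuous_tubeData`. [folklore] -/
theorem higherOrder_tubeData_EF : open Literature.Geometry.Lorentzian in ∀ {Λ : ℝ → lorentzGroup} {ξ : ℝ → E3} (a : ℝ), ContDiff ℝ ((⊤ : ℕ∞) : WithTop ℕ∞) (fun t ↦ ((Λ t : E4 ≃L[ℝ] E4) : E4 →L[ℝ] E4)) → ContDiff ℝ ((⊤ : ℕ∞) : WithTop ℕ∞) ξ → Continuous (fun z : E4 ↦ Kerr.radius a (poincareInv (Λ (z 0)) (E4.ofTimeSpace (z 0) (ξ (z 0))) z)) ∧ Continuous (fun z : E4 ↦ ‖E4.spatial z - ξ (z 0)‖) :=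
  fun a hΛ hξ ↦ higherOrder_continuous_tubeData a hΛ hξ

end Summit.FinalStateConjecture.FinalStateConjecture.Theorems.SublinearIsFree.Slaving

end
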